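import Mathlib
import Literature.NumberTheory.LFunctions.Zhang2022.Section17U024InputsE
import Literature.NumberTheory.LFunctions.Zhang2022.Section17SummedErrorAlpha1
import Literature.NumberTheory.LFunctions.Zhang2022.Section17Eq179ChiEdges
import Literature.NumberTheory.LFunctions.Zhang2022.Section17Eq178Chi
import HarnessLib

/-!
# Zhang (2022) §17 (17.8)→(17.9): the `I₄⁻` chain at the PARAMETER `e″ = e1pp` (RT-05 E-edges) —
# u024-χ, u026, (17.9)ᴿ and the leaf `Eq17_9RelE e1pp c′` from the χ-nodes of record and
# `Lemma151ChiRE e1pp` (the form of Lemma 15.1 the Appendix-B cone delivers)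

Topic `Literature/NumberTheory/LFunctions/Zhang2022` (Landau–Siegel audit tree; verdict-neutral).
Y. Zhang, *Discrete mean estimates and the Landau–Siegel zero*, arXiv:2211.02515v1 (2022)
[Zhang2022LandauSiegel] — **an unrefereed manuscript under adjudication**; the displays are CLAIM nodes
of `Typed.Section17` / `TypedSection17RelE` / `TypedAppendixB`, stated not asserted; nothing here bears on
Theorems 1–2 of the source or on Landau–Siegel zeros. §17 p. 98 (tex L4811–L4849; DAG `Z22:(17.8)`,
`Z22:§17.u021`, `Z22:§17.u024`, `Z22:§17.u026`, `Z22:(17.9)`).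

WHY THIS FILE (ZHANG-L lane; RE-TYPE RT-05 = zl-lead R-22/R-28, ref-chief C1–C5; WP16-PLAN W16-S5a
follow-up (1); referee word zl-w16-ref-2 2026-08-27T01:19Z; cross-WP flag zl-deputy 01:09Z). Since
`SkeletonWholeDAGv27` the skeleton binder for (17.9) is `h17_9 : ∀ c′ ≥ c₁, Typed.Section17.Eq17_9RelE
e1ppD c′` — (17.9)ᴿ with `𝔢₁ := frakeE e1ppD 1`, the DERIVED `e″₁ⱼ = −jπi·b*` of App. B's own
computation, NOT the value stated in Lemma 15.1/(B.3) (rows G-L4t10-1 / G-num2-1 / D-G-num2-1). The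
tree's χ-reading chain `Phi3Eval.eq17_9Rel_of_chiNodes` (`Section17Eq179ChiEdges`, zl-w16-p3) is the
`e1ppj` instance (`Eq17_9Rel = Eq17_9RelE e1ppj`, `rfl`) over `Skeleton.Lemma151Chi` (rate `α𝓛`). This
file is its E-GENERIC twin over the Lemma-15.1 form WP15 delivers, `Skeleton.Lemma151ChiRE e1pp c′`
(`TypedSection15E`; rate `α₁ = α log T` = the PRINTED rate of Lemma 15.1, p. 86 tex L4273–4276;
producer `Section15EChain.lemma151ChiRE_of_evals (e1pp)` from the App.-B legs — ONE WP15 discharge at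
`e1ppD` then serves h15_22, h16_16 and h17_9). The edges are zl-w16-p3's, re-run VERBATIM with
`frake 1 ↦ frakeE e1pp 1` (every edge is constant-agnostic: `𝔢₁` enters as an opaque complex number; the
window step is the tree's `Skeleton.window_sum_evalRel_beta2` at `c := frakeE e1pp 1`) and with the u023
error at rate `α₁` (the summed error at rate `α₁` is zl-libA-p1's `Phi3Eval.step17_hE_alpha1_holds`,
`Section17SummedErrorAlpha1`; u023χ(RE) and u025(E) are `Section17U024InputsE`). PROVED here (theorems only):

* `step17_u024ChiE_of (e1pp)` / **`step17_u024ChiRelE_of (e1pp)`** — u024-χ at the parameter, absolute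
  `o(1)` and the typed relative node `Step17_u024ChiRelE e1pp c′` BY NAME, from `Step17_u021Chi c′`
  (typed χ-node, 𝔢-free) and `Lemma151ChiRE e1pp c′`;
* **`step17_u026RelE_of (e1pp)`** — `Step17_u026RelE e1pp c′` BY NAME from `Eq17_8Chi c′` (typed, 𝔢-free),
  `Step17_u024ChiRelE e1pp c′` and `Step17_u025E e1pp c′` (a THEOREM for every `e1pp`:
  `Phi3Eval.step17_u025E_holds`);
* **`eq17_9RelE_of_u026RelE (e1pp)`** — `Eq17_7 c′ → Step17_u026RelE e1pp c′ → Eq17_9RelE e1pp c′`;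
* **`eq17_9RelE_of_chiNodes (e1pp) (c′) : Eq17_7 c′ → Eq17_8Chi c′ → Step17_u021Chi c′ →
  Skeleton.Lemma151ChiRE e1pp c′ → Eq17_9RelE e1pp c′`** — the text asked for by WP16-PLAN W16-S5a (1),
  the closer-shape of the leaf h17_9 at ANY `e1pp`; `step17_u026RelE_of_chiNodes` likewise;
* (companion `Section17Eq179ChiEdgesELegs`: the same assembled down to the Appendix-B one-variable
  evaluations, `eq17_9RelD_of_chiNodes_of_appB_legs : Eq17_7 → Eq17_8Chi → Step17_u021Chi → StepB_mu2R →
  StepB_mu3R → StepB_u012R → StepB_u015aR → StepB_u015bR → Eq17_9RelE e1ppD c′`, mirroring WP15's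
  `Typed.Section15C.eq15_22D_of_appB_legs`);
* a bridge `Skeleton.lemma151ChiRE_of_lemma151ChiE` (rate `α𝓛` ⇒ rate `α₁`, E-twin of the tree's
  `lemma151ChiR_of_lemma151Chi`), and sanity `example`s at `e1ppj` recovering the v19–v23 leaf
  `Eq17_9Rel c′` over `Lemma151ChiR c′` (RT-05 C1/C2: `X = XE e1ppj` by `rfl`).
* rev 2 (§7, WP16 RULING RT16-int-4 (b)): the u024-ENTRY **`eq17_9RelE_of_u024E (e1pp) (c′) :
  Eq17_7 c′ → Eq17_8Chi c′ → Step17_u024ChiRelE e1pp c′ → Eq17_9RelE e1pp c′`** (the typed R1-χ node of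
  record `Step17_u024ChiRelE e1ppD c′` is its hypothesis), and the forms with (17.8)-χ DISCHARGED by
  zl-w16-p9's unconditional `Typed.Section17.eq17_8Chi_holds`: `eq17_9RelE_of_eq17_7_of_u024E`,
  `eq17_9RelE_of_eq17_7_u021_lemma151ChiRE`, `step17_u026RelE_of_u024E`.

So the leaf h17_9 (binder `Eq17_9RelE e1ppD c′`) is REDUCED to the 𝔢-free χ-nodes `Eq17_7` ((17.7):
u011 + shift + `Ψ₁ → Ψ` extension; zl-w16-p7 / zl-w14-p2), `Eq17_8Chi` ((17.3)-mirror; zl-w16-p9),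
`Step17_u021Chi` (zl-libA-typer, reduced to one remainder) and EITHER `Skeleton.Lemma151ChiRE e1ppD c′` OR
the five App.-B legs `StepB_mu2R/mu3R/u012R/u015aR/u015bR` (WP15; the same legs as h15_22). WHAT THIS
IS NOT: a proof of any of those nodes; any claim about Theorems 1–2 of the source or about Landau–Siegel
zeros; nothing here bears on the cell's verdict on (8.24) or on the §18 margin.

## References

* Y. Zhang, arXiv:2211.02515v1 (2022), §17 pp. 97–98 ((17.7)–(17.9), u021–u026); §15 (15.1),
  Lemma 15.1 p. 86; App. B (B.1)–(B.3) pp. 106–108. [cite: Zhang2022LandauSiegel, §17 (17.9) p.98]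
-/

noncomputable section

open Complex Real Finset
open Literature.NumberTheory.LFunctions.Zhang2022.Skeleton
open Literature.NumberTheory.LFunctions.Zhang2022.Typed.Section17

/-! ## §0. Lemma 15.1 (χ, parameter `e1pp`): rate `α𝓛` ⇒ rate `α₁` -/

namespace Literature.NumberTheory.LFunctions.Zhang2022.Skeleton

/-- `Lemma151ChiE e1pp c′` (error `α𝓛·τ₂`) implies `Lemma151ChiRE e1pp c′` (error `α₁·τ₂`, the printed
rate) — the E-twin of the tree's `lemma151ChiR_of_lemma151Chi` (`α𝓛 ≤ α₁` for `D ≥ 3`,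
`alpha_mul_ell_le_alpha1`), so holders of the stronger `α𝓛` form may use the chain below.
[cite: Zhang2022LandauSiegel, §15 Lemma 15.1 p. 86] -/
theorem lemma151ChiRE_of_lemma151ChiE {e1pp : ℕ → ℂ} {c' : ℝ} (h : Lemma151ChiE e1pp c') :
    Lemma151ChiRE e1pp c' := by
  obtain ⟨C, D₀, hD₀⟩ := h
  refine ⟨|C|, max D₀ 3, fun D _ χ hD hq hp hA j hj n₁ hn hT => ?_⟩
  have hD3 : 3 ≤ D := le_trans (le_max_right _ _) hD
  refine (hD₀ D χ (le_trans (le_max_left _ _) hD) hq hp hA j hj n₁ hn hT).trans ?_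
  have hτ : (0 : ℝ) ≤ n₁.divisors.card := Nat.cast_nonneg _
  have hαℓ : 0 ≤ alpha D * ell D := mul_nonneg (alpha_pos hD3).le (by linarith [one_lt_ell hD3])
  calc C * alpha D * ell D * n₁.divisors.card = C * (alpha D * ell D) * n₁.divisors.card := by ring
    _ ≤ |C| * (alpha D * ell D) * n₁.divisors.card := by gcongr; exact le_abs_self C
    _ ≤ |C| * alpha1 D * n₁.divisors.card := by gcongr; exact alpha_mul_ell_le_alpha1 hD3

end Literature.NumberTheory.LFunctions.Zhang2022.Skeleton

namespace Literature.NumberTheory.LFunctions.Zhang2022.Phi3Eval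

/-! ## §1. u024 in the χ-reading at the parameter: u021-χ + u023-χ(RE) + the summed error at rate `α₁` -/

/-- **§17.u024 in the χ-reading, 𝔢₁ := `frakeE e1pp 1`, ABSOLUTE form**: from the typed χ-node
`Step17_u021Chi c′` (RT16-int-1; 𝔢-free), u023-χ at the parameter and the printed rate
(`step17_u023ChiRE_of_lemma151ChiRE`, from `Lemma151ChiRE e1pp c′`) and the summed-error estimate at
rate `α₁` (zl-libA-p1's `step17_hE_alpha1_holds`; row G-d58-1): `V_χ = 𝔢₁[e1pp] Σ_{l<D⁴}(ν(l)/l)Σ_{l=l₁l₂}χ(l₁)τ₂(l₁)ν₁*(l₂)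
+ o(1)`. The bookkeeping is zl-w16-p3's `step17_u024Chi_of` verbatim (`frake 1 ↦ frakeE e1pp 1`,
`α𝓛 ↦ α₁`). [cite: Zhang2022LandauSiegel, §17 u024 p.98] -/
theorem step17_u024ChiE_of (e1pp : ℕ → ℂ) (c' : ℝ) (h21 : Step17_u021Chi c')
    (h151 : Lemma151ChiRE e1pp c') :
    ∀ ε : ℝ, 0 < ε → ForAllLarge fun D _ χ => AssumptionA D χ →
      ‖(∑' n : ℕ, LSeries.convolution (fun n => bcoef D n * χ (n : ZMod D)) (nuOneStar c' χ) n *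
            varrho17 c' χ n / (n : ℂ)) -
          frakeE e1pp 1 * ∑ l ∈ Finset.Ico 1 (D ^ 4), nu χ l / (l : ℂ) *
            ∑ q ∈ l.divisorsAntidiagonal,
              χ (q.1 : ZMod D) * (q.1.divisors.card : ℂ) * nuOneStar c' χ q.2‖ ≤ ε := by
  intro ε hε
  obtain ⟨C, hC⟩ := step17_u023ChiRE_of_lemma151ChiRE e1pp c' h151
  have hε2 : 0 < ε / 2 := by positivity
  have hδ : 0 < ε / 2 / (|C| + 1) := by positivity
  obtain ⟨D₀, h⟩ := ((h21 _ hε2).and hC).and (step17_hE_alpha1_holds c' _ hδ)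
  refine ⟨D₀, fun D _ χ hD hq hp hA => ?_⟩
  obtain ⟨⟨e21, e23⟩, eE⟩ := h D χ hD hq hp
  replace e21 := e21 hA
  replace e23 := e23 hA
  replace eE := eE hA
  -- names
  set V : ℂ := ∑' n : ℕ, LSeries.convolution (fun n => bcoef D n * χ (n : ZMod D)) (nuOneStar c' χ) n *
    varrho17 c' χ n / (n : ℂ) with hV
  set inner : ℕ → ℂ := fun l₁ => ∑' m₁ : ℕ,
    if Nat.Coprime m₁ (frakq D) then
      bcoef D (l₁ * m₁) * χ ((l₁ * m₁ : ℕ) : ZMod D) * kappa2bar c' D m₁ / (m₁ : ℂ) else 0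
    with hinner
  set U : ℂ := ∑ l ∈ Finset.Ico 1 (D ^ 4), nu χ l / (l : ℂ) *
    ∑ q ∈ l.divisorsAntidiagonal, ∑' m₁ : ℕ,
      if Nat.Coprime m₁ (frakq D) then
        bcoef D (q.1 * m₁) * χ ((q.1 * m₁ : ℕ) : ZMod D) * nuOneStar c' χ q.2 *
          kappa2bar c' D m₁ / (m₁ : ℂ) else 0 with hU
  set W : ℂ := ∑ l ∈ Finset.Ico 1 (D ^ 4), nu χ l / (l : ℂ) *
    ∑ q ∈ l.divisorsAntidiagonal, χ (q.1 : ZMod D) * (q.1.divisors.card : ℂ) * nuOneStar c' χ q.2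
    with hW
  set E : ℝ := ∑ l ∈ Finset.Ico 1 (D ^ 4), ‖nu χ l‖ / l *
    ∑ q ∈ l.divisorsAntidiagonal, (q.1.divisors.card : ℝ) * ‖nuOneStar c' χ q.2‖ with hEdef
  -- pull `ν₁*(l₂)` out of the inner series
  have hpull : ∀ l₁ l₂ : ℕ, (∑' m₁ : ℕ, if Nat.Coprime m₁ (frakq D) then
      bcoef D (l₁ * m₁) * χ ((l₁ * m₁ : ℕ) : ZMod D) * nuOneStar c' χ l₂ * kappa2bar c' D m₁ / (m₁ : ℂ)
      else 0) = nuOneStar c' χ l₂ * inner l₁ := by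
    intro l₁ l₂
    rw [hinner]
    simp only
    rw [← tsum_mul_left]
    refine tsum_congr fun m₁ => ?_
    split_ifs
    · ring
    · simp
  have hU' : U = ∑ l ∈ Finset.Ico 1 (D ^ 4), nu χ l / (l : ℂ) *
      ∑ q ∈ l.divisorsAntidiagonal, nuOneStar c' χ q.2 * inner q.1 := by
    rw [hU]
    refine Finset.sum_congr rfl fun l _ => ?_
    congr 1
    exact Finset.sum_congr rfl fun q _ => hpull q.1 q.2
  -- the termwise substitution of u023-χ
  have hdiff : U - frakeE e1pp 1 * W = ∑ l ∈ Finset.Ico 1 (D ^ 4), nu χ l / (l : ℂ) *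
      ∑ q ∈ l.divisorsAntidiagonal, nuOneStar c' χ q.2 *
        (inner q.1 - frakeE e1pp 1 * χ (q.1 : ZMod D) * (q.1.divisors.card : ℂ)) := by
    rw [hU', hW, Finset.mul_sum, ← Finset.sum_sub_distrib]
    refine Finset.sum_congr rfl fun l _ => ?_
    rw [← mul_assoc, mul_comm (frakeE e1pp 1) (nu χ l / (l : ℂ)), mul_assoc, ← mul_sub, Finset.mul_sum,
      ← Finset.sum_sub_distrib]
    congr 1
    refine Finset.sum_congr rfl fun q _ => ?_
    ring
  have hbound : ‖U - frakeE e1pp 1 * W‖ ≤ C * alpha1 D * E := by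
    rw [hdiff]
    refine (norm_sum_le _ _).trans ?_
    rw [hEdef, Finset.mul_sum]
    refine Finset.sum_le_sum fun l hl => ?_
    rw [norm_mul, norm_div, Complex.norm_natCast]
    have hl0 : (0 : ℝ) ≤ ‖nu χ l‖ / (l : ℝ) := by positivity
    rw [mul_comm (C * alpha1 D), mul_assoc]
    refine mul_le_mul_of_nonneg_left ?_ hl0
    refine (norm_sum_le _ _).trans ?_
    rw [Finset.sum_mul]
    refine Finset.sum_le_sum fun q hq => ?_
    have hl' := Finset.mem_Ico.1 hl
    have hq' := Nat.mem_divisorsAntidiagonal.1 hq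
    have hq1dvd : q.1 ∣ l := ⟨q.2, hq'.1.symm⟩
    have hq1pos : 0 < q.1 := Nat.pos_of_ne_zero fun h0 => hq'.2 (by rw [← hq'.1, h0, zero_mul])
    have hq1 : 1 ≤ q.1 := hq1pos
    have hq4 : q.1 < D ^ 4 := lt_of_le_of_lt (Nat.le_of_dvd (by omega) hq1dvd) hl'.2
    rw [norm_mul]
    have h23q := e23 q.1 hq1 hq4
    calc ‖nuOneStar c' χ q.2‖ * ‖inner q.1 - frakeE e1pp 1 * χ (q.1 : ZMod D) * (q.1.divisors.card : ℂ)‖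
        ≤ ‖nuOneStar c' χ q.2‖ * (C * alpha1 D * q.1.divisors.card) :=
          mul_le_mul_of_nonneg_left h23q (norm_nonneg _)
      _ = (q.1.divisors.card : ℝ) * ‖nuOneStar c' χ q.2‖ * (C * alpha1 D) := by ring
  -- sizes
  have hℓ : 0 ≤ ell D := Real.log_natCast_nonneg D
  have hα : 0 ≤ alpha D := by
    rw [alpha, bigP, Real.log_exp]; exact div_nonneg Real.pi_pos.le (pow_nonneg hℓ 9)
  have hα1 : 0 ≤ alpha1 D := by
    rw [alpha1, log_bigT]; exact mul_nonneg hα (Real.rpow_nonneg hℓ _)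
  have hE0 : 0 ≤ E := Finset.sum_nonneg fun l _ => mul_nonneg (by positivity)
    (Finset.sum_nonneg fun q _ => by positivity)
  have hαℓE : 0 ≤ alpha1 D * E := mul_nonneg hα1 hE0
  have hCE : C * alpha1 D * E ≤ ε / 2 := by
    calc C * alpha1 D * E = C * (alpha1 D * E) := by ring
      _ ≤ |C| * (alpha1 D * E) := mul_le_mul_of_nonneg_right (le_abs_self C) hαℓE
      _ ≤ |C| * (ε / 2 / (|C| + 1)) := mul_le_mul_of_nonneg_left eE (abs_nonneg C)
      _ ≤ ε / 2 := by
          rw [mul_div_assoc', div_le_iff₀ (by positivity)]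
          nlinarith [abs_nonneg C]
  have hsplit : V - frakeE e1pp 1 * W = (V - U) + (U - frakeE e1pp 1 * W) := by ring
  show ‖V - frakeE e1pp 1 * W‖ ≤ ε
  rw [hsplit]
  calc ‖(V - U) + (U - frakeE e1pp 1 * W)‖ ≤ ‖V - U‖ + ‖U - frakeE e1pp 1 * W‖ := norm_add_le _ _
    _ ≤ ε / 2 + C * alpha1 D * E := add_le_add e21 hbound
    _ ≤ ε / 2 + ε / 2 := by linarith
    _ = ε := by ring

/-- **u024-χ in the relative budget at the parameter — the typed E-twin node
`Typed.Section17.Step17_u024ChiRelE e1pp c′` BY NAME** (WP16-PLAN Sketch S4 at the parameter), a corollary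
of the absolute `step17_u024ChiE_of` (`ε ≤ ε(𝔞+1)`). [cite: Zhang2022LandauSiegel, §17 u024 p.98] -/
theorem step17_u024ChiRelE_of (e1pp : ℕ → ℂ) (c' : ℝ) (h21 : Step17_u021Chi c')
    (h151 : Lemma151ChiRE e1pp c') : Step17_u024ChiRelE e1pp c' := fun ε hε =>
  (step17_u024ChiE_of e1pp c' h21 h151 ε hε).mono fun D _ χ _ _ h hA => by
    have e := h hA
    have hA0 : 0 ≤ frakA χ := frakA_nonneg χ
    nlinarith

/-! ## §2. u026 at the parameter, relative budget -/

/-- **§17.u026 at the parameter, relative budget — `Typed.Section17.Step17_u026RelE e1pp c′` BY NAME**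
("`Φ₃⁻(p) = 𝔢₁[e1pp]𝔞p + o((𝔞+1)p)`" uniformly in `p ∼ P`) from (17.8)-χ (typed node `Eq17_8Chi c′`,
𝔢-free), u024-χ in the relative budget (`Step17_u024ChiRelE e1pp c′`) and u025 at the parameter
(`Step17_u025E e1pp c′`): `Φ₃⁻(p) = pV_χ + o(p)`, `V_χ = 𝔢₁W + o(𝔞+1)`, `𝔢₁W = 𝔢₁Σν²/l + o(1) = 𝔢₁𝔞 + o(1)`.
zl-w16-p3's bookkeeping (`eq17_9Rel_of_partsChiRel`, first half) verbatim at the parameter.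
[cite: Zhang2022LandauSiegel, §17 u026 p.98] -/
theorem step17_u026RelE_of (e1pp : ℕ → ℂ) {c' : ℝ} (h8 : Eq17_8Chi c')
    (h24 : Step17_u024ChiRelE e1pp c') (h25 : Step17_u025E e1pp c') : Step17_u026RelE e1pp c' := by
  intro ε hε
  have hε4 : 0 < ε / 4 := by positivity
  obtain ⟨D₀, h⟩ := ((h8 _ hε4).and (h24 _ hε4)).and (h25 _ hε4)
  refine ⟨D₀, fun D _ χ hD hq hp hA p hpw => ?_⟩
  obtain ⟨⟨e8, e24⟩, e25⟩ := h D χ hD hq hp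
  set V : ℂ := ∑' n : ℕ, LSeries.convolution (fun n => bcoef D n * χ (n : ZMod D))
    (nuOneStar c' χ) n * varrho17 c' χ n / (n : ℂ) with hV
  set W : ℂ := ∑ l ∈ Finset.Ico 1 (D ^ 4), nu χ l / (l : ℂ) *
    ∑ q ∈ l.divisorsAntidiagonal, χ (q.1 : ZMod D) * (q.1.divisors.card : ℂ) * nuOneStar c' χ q.2
    with hW
  set R : ℂ := ∑ l ∈ Finset.Ico 1 (D ^ 4), nu χ l ^ 2 / (l : ℂ) with hR
  have hA0 : 0 ≤ frakA χ := frakA_nonneg χ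
  have hA1 : 1 ≤ frakA χ + 1 := by linarith
  have h1 : ‖Phi3minus c' χ p - (p : ℂ) * V‖ ≤ ε / 4 * p := e8 hA p hpw
  have h2 : ‖V - frakeE e1pp 1 * W‖ ≤ ε / 4 * (frakA χ + 1) := e24 hA
  obtain ⟨h3, h4⟩ := e25 hA
  have hp0 : (0 : ℝ) ≤ p := Nat.cast_nonneg p
  have hV' : ‖V - frakeE e1pp 1 * frakA χ‖ ≤ 3 * (ε / 4) * (frakA χ + 1) := by
    calc ‖V - frakeE e1pp 1 * frakA χ‖
        = ‖(V - frakeE e1pp 1 * W) + (frakeE e1pp 1 * W - frakeE e1pp 1 * R) + (frakeE e1pp 1 * R - frakeE e1pp 1 * frakA χ)‖ := by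
          ring_nf
      _ ≤ ‖V - frakeE e1pp 1 * W‖ + ‖frakeE e1pp 1 * W - frakeE e1pp 1 * R‖ + ‖frakeE e1pp 1 * R - frakeE e1pp 1 * frakA χ‖ :=
          (norm_add_le _ _).trans (add_le_add (norm_add_le _ _) le_rfl)
      _ ≤ ε / 4 * (frakA χ + 1) + ε / 4 + ε / 4 := add_le_add (add_le_add h2 h3) h4
      _ ≤ 3 * (ε / 4) * (frakA χ + 1) := by nlinarith
  calc ‖Phi3minus c' χ p - frakeE e1pp 1 * frakA χ * (p : ℂ)‖
      = ‖(Phi3minus c' χ p - (p : ℂ) * V) + (p : ℂ) * (V - frakeE e1pp 1 * frakA χ)‖ := by ring_nf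
    _ ≤ ‖Phi3minus c' χ p - (p : ℂ) * V‖ + ‖(p : ℂ) * (V - frakeE e1pp 1 * frakA χ)‖ := norm_add_le _ _
    _ ≤ ε / 4 * p + p * (3 * (ε / 4) * (frakA χ + 1)) := by
        rw [norm_mul, Complex.norm_natCast]
        exact add_le_add h1 (mul_le_mul_of_nonneg_left hV' hp0)
    _ ≤ ε * (frakA χ + 1) * p := by
        have h14 : ε / 4 * p ≤ ε / 4 * p * (frakA χ + 1) :=
          le_mul_of_one_le_right (by positivity) hA1
        nlinarith

/-! ## §3. (17.9)ᴿ at the parameter from (17.7) and u026 -/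

/-- **(17.9)ᴿ at the parameter — `Typed.Section17.Eq17_9RelE e1pp c′` BY NAME — from (17.7)
(`Eq17_7 c′`, 𝔢-free) and u026 at the parameter in the relative budget (`Step17_u026RelE e1pp c′`)**:
the window sum with the relative per-modulus error and `(pt₀)^{β₂} = 1 + O(α𝓛)` is the tree's
`Skeleton.window_sum_evalRel_beta2` at `c := frakeE e1pp 1` (constant-agnostic); then (17.7) moves
`Σ_{p∼P}(pt₀)^{β₂}Φ₃⁻(p)` to `Σ_{ψ∈Ψ₁}(p_ψt₀)^{β₃}I₄⁻(ψ)`. zl-w16-p3's bookkeeping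
(`eq17_9Rel_of_partsChiRel`, second half) verbatim at the parameter. [cite: Zhang2022LandauSiegel, §17 (17.9) p.98] -/
theorem eq17_9RelE_of_u026RelE (e1pp : ℕ → ℂ) (c' : ℝ) (h7 : Eq17_7 c')
    (h26 : Step17_u026RelE e1pp c') : Eq17_9RelE e1pp c' := by
  -- the window sum with the relative per-modulus error (`Skeleton.window_sum_evalRel_beta2`)
  have hΦ : ∀ ε : ℝ, 0 < ε → ForAllLarge fun D _ χ => AssumptionA D χ → ∀ p ∈ primeWindow D,
      ‖(fun D χ p => Phi3minus c' χ p) D χ p - frakeE e1pp 1 * p *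
        (fun D χ => if h : D = 0 then (0 : ℂ) else ((@frakA D ⟨h⟩ χ : ℝ) : ℂ)) D χ‖ ≤
          ε * (frakA χ + 1) * p := by
    intro ε hε
    refine (h26 ε hε).mono fun D _ χ _ _ h hA p hp => ?_
    have e := h hA p hp
    beta_reduce
    rw [dif_neg (NeZero.ne D)]
    rwa [show frakeE e1pp 1 * (frakA χ : ℂ) * (p : ℂ) = frakeE e1pp 1 * (p : ℂ) * (frakA χ : ℂ) by ring] at e
  have hX : ∀ δ : ℝ, 0 < δ → ForAllLarge fun D _ χ => AssumptionA D χ →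
      ‖(fun D χ => if h : D = 0 then (0 : ℂ) else ((@frakA D ⟨h⟩ χ : ℝ) : ℂ)) D χ - frakA χ‖ ≤ δ := by
    intro δ hδ
    refine ⟨1, fun D _ χ _ _ _ _ => ?_⟩
    beta_reduce
    rw [dif_neg (NeZero.ne D), sub_self, norm_zero]
    exact hδ.le
  have key := window_sum_evalRel_beta2 c' (c := frakeE e1pp 1) hΦ hX
  intro ε hε
  have hε2 : 0 < ε / 2 := by positivity
  refine ((h7 _ hε2).and (key _ hε2)).mono fun D _ χ _ _ h hA => ?_
  obtain ⟨e7, e9⟩ := h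
  have a := e7 hA
  have b := e9 hA
  beta_reduce at b
  have hA0 : 0 ≤ frakA χ := frakA_nonneg χ
  have hPnn : 0 ≤ frakP D := frakP_nonneg D
  set Xm : ℂ := ∑ x ∈ finsetOf (PsiOne χ),
    (((x.p : ℝ) * t0 D : ℝ) : ℂ) ^ beta3 c' D * I4 c' χ x (-alpha D) with hXm
  set Y : ℂ := ∑ p ∈ primeWindow D, (((p : ℝ) * t0 D : ℝ) : ℂ) ^ beta2 c' D * Phi3minus c' χ p
    with hY
  calc ‖Xm - frakeE e1pp 1 * frakA χ * frakP D‖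
      = ‖(Xm - Y) + (Y - frakeE e1pp 1 * frakA χ * frakP D)‖ := by ring_nf
    _ ≤ ‖Xm - Y‖ + ‖Y - frakeE e1pp 1 * frakA χ * frakP D‖ := norm_add_le _ _
    _ ≤ ε / 2 * frakP D + ε / 2 * (frakA χ + 1) * frakP D := add_le_add a b
    _ ≤ ε * (frakA χ + 1) * frakP D := by nlinarith [mul_nonneg hA0 hPnn]


/-! ## §4. The leaf at the parameter from the χ-nodes of record and `Lemma151ChiRE e1pp` -/

/-- `Step17_u026RelE e1pp c′` from `Eq17_8Chi c′`, `Step17_u021Chi c′` and `Lemma151ChiRE e1pp c′`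
(u025 at the parameter is the theorem `step17_u025E_holds`). [cite: Zhang2022LandauSiegel, §17 u026 p.98] -/
theorem step17_u026RelE_of_chiNodes (e1pp : ℕ → ℂ) (c' : ℝ) (h8 : Eq17_8Chi c')
    (h21 : Step17_u021Chi c') (h151 : Lemma151ChiRE e1pp c') : Step17_u026RelE e1pp c' :=
  step17_u026RelE_of e1pp h8 (step17_u024ChiRelE_of e1pp c' h21 h151) (step17_u025E_holds e1pp c')

/-- **The leaf (17.9)ᴿ at ANY value of `e″` from the typed χ-nodes of record and the Lemma-15.1 form
WP15 delivers** (WP16-PLAN W16-S5a follow-up (1), text verbatim): `Eq17_7 c′ → Eq17_8Chi c′ →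
Step17_u021Chi c′ → Skeleton.Lemma151ChiRE e1pp c′ → Typed.Section17.Eq17_9RelE e1pp c′`. At
`e1pp := e1ppD` the conclusion is the skeleton binder `h17_9` of `SkeletonWholeDAGv27` BY NAME; at
`e1pp := e1ppj` it is the v19–v26 leaf `Eq17_9Rel c′` (`rfl`). [cite: Zhang2022LandauSiegel, §17 (17.9) p.98] -/
theorem eq17_9RelE_of_chiNodes (e1pp : ℕ → ℂ) (c' : ℝ) (h7 : Eq17_7 c') (h8 : Eq17_8Chi c')
    (h21 : Step17_u021Chi c') (h151 : Lemma151ChiRE e1pp c') : Eq17_9RelE e1pp c' :=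
  eq17_9RelE_of_u026RelE e1pp c' h7 (step17_u026RelE_of_chiNodes e1pp c' h8 h21 h151)

/-- The same over the stronger rate-`α𝓛` form `Skeleton.Lemma151ChiE e1pp c′` (bridge
`lemma151ChiRE_of_lemma151ChiE`). [cite: Zhang2022LandauSiegel, §17 (17.9) p.98] -/
theorem eq17_9RelE_of_chiNodes_of_lemma151ChiE (e1pp : ℕ → ℂ) (c' : ℝ) (h7 : Eq17_7 c')
    (h8 : Eq17_8Chi c') (h21 : Step17_u021Chi c') (h151 : Lemma151ChiE e1pp c') :
    Eq17_9RelE e1pp c' :=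
  eq17_9RelE_of_chiNodes e1pp c' h7 h8 h21 (lemma151ChiRE_of_lemma151ChiE h151)

/-! ## §6. Sanity at the stated `e″ = e1ppj` (RT-05 C1/C2: `X = XE e1ppj` by `rfl`) -/

/-- At `e1pp := e1ppj` the generic leaf edge is the v19–v26 leaf `Eq17_9Rel c′` over the `α₁`-form
`Lemma151ChiR c′` of Lemma 15.1 (both sides unfold by `rfl`: `Lemma151ChiRE e1ppj = Lemma151ChiR`,
`Eq17_9RelE e1ppj = Eq17_9Rel`). [cite: Zhang2022LandauSiegel, §17 (17.9) p.98] -/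
example (c' : ℝ) (h7 : Eq17_7 c') (h8 : Eq17_8Chi c') (h21 : Step17_u021Chi c')
    (h151 : Lemma151ChiR c') : Eq17_9Rel c' :=
  eq17_9RelE_of_chiNodes e1ppj c' h7 h8 h21 h151

/-- … and over the tree's rate-`α𝓛` node `Lemma151Chi c′` it recovers the conclusion of zl-w16-p3's
`eq17_9Rel_of_chiNodes`. [cite: Zhang2022LandauSiegel, §17 (17.9) p.98] -/
example (c' : ℝ) (h7 : Eq17_7 c') (h8 : Eq17_8Chi c') (h21 : Step17_u021Chi c')
    (h151 : Lemma151Chi c') : Eq17_9Rel c' :=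
  eq17_9RelE_of_chiNodes_of_lemma151ChiE e1ppj c' h7 h8 h21 h151

/-! ## §7. The u024-entry of the E-port (WP16 RULING RT16-int-4 (b)) and the forms with (17.8)-χ
discharged (`Typed.Section17.eq17_8Chi_holds`, zl-w16-p9, unconditional) — rev 2, append-only -/

/-- **The u024-entry of the E-port** (WP16-PLAN W16-S5d, RT16-int-4 (b), text verbatim): from (17.7)
(`Eq17_7 c′`), (17.8)-χ (`Eq17_8Chi c′`) and the typed R1-χ node of record `Step17_u024ChiRelE e1pp c′`
(u021χ + u023χ + u024 merged in REL/E currency, TypedSection17RelE :88) to the leaf `Eq17_9RelE e1pp c′`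
— u025 at the parameter is the theorem `step17_u025E_holds`, then `step17_u026RelE_of` and
`eq17_9RelE_of_u026RelE`. Both admissible R1-χ routes (R-I: `step17_u024ChiRelE_of` from `Step17_u021Chi`
+ `Lemma151ChiRE e1pp`; R-II: a direct signed evaluation) end in its hypothesis `h24`.
[cite: Zhang2022LandauSiegel, §17 u024–(17.9) p.98] -/
theorem eq17_9RelE_of_u024E (e1pp : ℕ → ℂ) (c' : ℝ) (h7 : Eq17_7 c') (h8 : Eq17_8Chi c')
    (h24 : Step17_u024ChiRelE e1pp c') : Eq17_9RelE e1pp c' :=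
  eq17_9RelE_of_u026RelE e1pp c' h7 (step17_u026RelE_of e1pp h8 h24 (step17_u025E_holds e1pp c'))

/-- The same with (17.8)-χ DISCHARGED by zl-w16-p9's unconditional `Typed.Section17.eq17_8Chi_holds`
(`Section17Eq178Chi`): `Eq17_7 c′ → Step17_u024ChiRelE e1pp c′ → Eq17_9RelE e1pp c′`. At `e1pp := e1ppD`:
the binder h17_9 ⇐ {(17.7), R1-χ node}. [cite: Zhang2022LandauSiegel, §17 (17.8)–(17.9) p.98] -/
theorem eq17_9RelE_of_eq17_7_of_u024E (e1pp : ℕ → ℂ) (c' : ℝ) (h7 : Eq17_7 c')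
    (h24 : Step17_u024ChiRelE e1pp c') : Eq17_9RelE e1pp c' :=
  eq17_9RelE_of_u024E e1pp c' h7 (eq17_8Chi_holds c') h24

/-- Route R-I with (17.8)-χ discharged: `Eq17_7 c′ → Step17_u021Chi c′ → Skeleton.Lemma151ChiRE e1pp c′ →
Eq17_9RelE e1pp c′` (`eq17_9RelE_of_chiNodes` with `h8 := eq17_8Chi_holds c′`). At `e1pp := e1ppD` the
leaf h17_9 then reads `eq17_9RelE_of_eq17_7_u021_lemma151ChiRE e1ppD c′ h7 h21 h151`, with
`h151 : Lemma151ChiRE e1ppD c′` = WP15's App.-B deliverable (`Skeleton.lemma151ChiRE_e1ppD_of_appB_legs`,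
zl-w09-p5). [cite: Zhang2022LandauSiegel, §17 (17.9) p.98] -/
theorem eq17_9RelE_of_eq17_7_u021_lemma151ChiRE (e1pp : ℕ → ℂ) (c' : ℝ) (h7 : Eq17_7 c')
    (h21 : Step17_u021Chi c') (h151 : Lemma151ChiRE e1pp c') : Eq17_9RelE e1pp c' :=
  eq17_9RelE_of_chiNodes e1pp c' h7 (eq17_8Chi_holds c') h21 h151

/-- `Step17_u026RelE e1pp c′` from the R1-χ node alone ((17.8)-χ and u025(E) are theorems).
[cite: Zhang2022LandauSiegel, §17 u026 p.98] -/
theorem step17_u026RelE_of_u024E (e1pp : ℕ → ℂ) (c' : ℝ) (h24 : Step17_u024ChiRelE e1pp c') :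
    Step17_u026RelE e1pp c' :=
  step17_u026RelE_of e1pp (eq17_8Chi_holds c') h24 (step17_u025E_holds e1pp c')

end Literature.NumberTheory.LFunctions.Zhang2022.Phi3Eval
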